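import Literature.MathematicalPhysics.QuantumFieldTheory.Balaban1983to89.B3Eq119VertexExpansion
import Literature.MathematicalPhysics.QuantumFieldTheory.Balaban1983to89.B3Eq18VertexExpansion

/-!
# `Balaban1983to89.B3Eq119TotalVertexFamily` — T. Bałaban, *(Higgs)₂,₃ quantum fields in a finite volume. III.
# Renormalization*, Commun. Math. Phys. **88** (1983) 411–445 [Balaban1983Higgs3], (1.19)–(1.21) p. 416: THE CHARGED
# SECTOR (`e ≠ 0`) OF THE PERTURBATIVE EXPANSION OF THE TWO-POINT FUNCTION (1.19) — the vertex-number expansion of the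
# CONCRETE `twoPoint` at ANY charge `e` relative to the `e = 0` Gaussian, with print's TOTAL vertex «(1.6), (1.7), (1.8),
# (1.10) with n′ = 0, B̃ = 0, g_k = 1» (plus the R-vertices (1.9)/(1.11) absorbing the charge orders `> n̄`)

statement-level skeleton of published theorems with citation tags; proofs where landed; nothing here is a claim about
the Yang–Mills mass gap

CITATION HEADER (lean-in-tree rule).  Part of the lit-balaban TYPED SKELETON (HOME `run/shared/lean/pub/lit-balaban/`),
Phase 2, proof seat p33 (gen 72, unit `lit-balaban-p33`); row **B3.Eq1.19-1.22** of `HOME/lit-balaban-r15/ROWS-B3.md`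
(fold owner r15; head `proved` under the lead's HEAD WORD Q25 — this file is an OPTIONAL located member of the (1.19)/(1.21)
cell, zero head weight: BRICK 6 of the target `B3TwoPointPerturbativeExpansion`, the `e > 0` companion of BRICK 4
(`B3TwoPointPerturbativeCoefficients` / `B3Eq119VertexExpansion`) and BRICK 5 (`B3GaussianPerturbationGraphs` /
`B3Eq119ConnectedGraphs`), whose honest scope was «e = 0 only: the vector-field vertices (1.8)/(1.10) stay inside the
unperturbed weight»).  REUSED BY NAME, nothing re-declared and nothing of another seat modified: BRICK 4's abstract
`TiltData` / `tiltExpect` / `TiltData.iteratedDerivWithin_tiltExpect_eq_ursellOf` / `TiltData.taylor_tiltExpect` and its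
(1.19)-side `vertices`, `freeMeasure`, `integrable_mul_exp_of_le_pow_quartic`, `twoPointFamily`; the typer's carrier
`HiggsLattice` (`action` (I.1.11), `covLaplaceForm`, `covDeriv`, `ChargeData.U`), the typer's `B3Sect1TwoPoint.twoPoint`
(1.19) / `action120` (1.20), the typer's ANALYTIC VERTICES `B3Eq18VertexExpansion.vertex16 … vertex111` ((1.6)–(1.11)
p. 413) with their expansion theorem `taylorCoeff_kinBond`, and `B1Eq113OneSidedDerivatives.covLaplaceForm_le`
(the unitarity bound `⟨φ,(−Δ^η_A)φ⟩ ≤ 4dη⁻²Σ_x η^d|φ(x)|²`).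

THE PRINT (p. 416 = PDF 6 of the held text `paper:balaban1983-higgs-2-3-quantum-fields-finite-volume`, L4–24, re-read this
session): «G^ε_{ab}(x, x′) = ⟨φ_a(x)φ_b(x′)⟩^ε = (Z^ε)^{−1}∫dA∫dφ e^{−S^ε(A,φ)}φ_a(x)φ_b(x′), x, x′ ∈ T_ε, (1.19) where
S^ε(A, φ) is the lattice action of the model given by (1.20) and Z^ε is the partition function. The function G^ε has a
perturbative expansion of the following structure (1.21) … Here we have a graphical description of the same type as in
(1.17), but with some simplifications. We have η = ε (hence L^kε = 1) and the only vertices are (1.6), (1.7) [with δm²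
instead of δm_i²(x)], (1.8), and (1.10) with n′ = 0, B̃ = 0, g_k = 1 (but without any restrictions on n). The propagators
are C^ε_0 for the scalar field and C^ε = (−Δ^ε + μ₀²)^{−1} for the vector field»; p. 413 (PDF 3): the vertices (1.6)–(1.11)
and «These vertices come from an expansion of the original lattice action»; [Balaban1982Higgs1] p. 605: «U(A) = exp(qεeA)
… Antisymmetry of q implies U(A)^* = U(−A)».

THE ARGUMENT (ours — print's sentence is formal perturbation theory).  Write the action (1.20) at charge `e` as
`S^ε_e = S^ε_{e=0, λ=0, m²} + 𝒱(e)` with the TOTAL VERTEX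
`𝒱(e)(A, φ) := V(φ) + ½(⟨φ,(−Δ^ε_{A})φ⟩_e − ⟨φ,(−Δ^ε_0)φ⟩)`, `V(φ) = Σ_x ε^d(λ|φ(x)|⁴ + ½δm²|φ(x)|²)` = −[(1.6)+(1.7)], and
the kinetic difference = −[the charged vertices]: by the typer's `taylorCoeff_kinBond` (with the (I.3.14) truncation order
`n̄` in the field and no `e′`-derivative), bond by bond and for EVERY `n̄`,
`−½ε^d|(D^ε_Aφ)(b)|² + ½ε^d|(∂^εφ)(b)|² = Σ_{1≤j≤n̄}(1.8)_{j,0} + Σ_{2≤j≤n̄, j even}(1.10)_{j,0} + (1.9)_{n̄} + (1.11)_{n̄}` at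
`B̃ = 0`, `g_k = 1`, the vertex of charge order `j` carrying `e^j` — so `−𝒱(e)` IS print's list of vertices, the charge
orders `> n̄` resummed into the R-vertices (1.9)/(1.11) (print: «without any restrictions on n», i.e. the formal series; here:
every finite `n̄` with the exact remainder).  Because `U` is UNITARY, `|½⟨φ,(−Δ^ε_A)φ⟩_e − ½⟨φ,(−Δ^ε_0)φ⟩| ≤ 2dε^{−2}Σ_xε^d|φ(x)|²`
UNIFORMLY IN `A` AND `e` (`covLaplaceForm_le`), hence `𝒱(e)` is bounded below (the quartic term (1.6) beats the quadratic
defect sitewise: `V_{λ,δm²} − κΣε^d|φ|² = V_{λ,δm²−2κ}`) and `|𝒱(e)| ≤ K(V₄ + 1)`: BRICK 4's hypotheses `TiltData` hold for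
`(ν⁰, φ_a(x)φ_b(x′), 𝒱(e))` with `ν⁰ = exp(−S^ε_{e=0,λ=0,m²})dAdφ` THE `e = 0` GAUSSIAN (free scalar field `C^ε_0`, free
vector field `C^ε`, independent).  Therefore the family `t ↦ ⟨φ_a(x)φ_b(x′)e^{−t𝒱(e)}⟩_{ν⁰}/⟨e^{−t𝒱(e)}⟩_{ν⁰}` is `C^∞` on
`[0, ∞)`, equals (1.19) at `t = 1`, its `n`-th right derivative at `0⁺` is the truncated expectation
`⟨φ_a(x)φ_b(x′); −𝒱(e); …; −𝒱(e)⟩ᵀ` W.R.T. THE `e = 0` GAUSSIAN — `n` total vertices, each the sum of print's four vertex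
types — and Taylor's formula at `0⁺` holds with Lagrange remainder.  At `e = 0` the family IS BRICK 4's `twoPointFamily`.

WHAT IS PROVED (0 `sorry`, no `Prop` fact; standard axioms).
* §1 `chargeZero C` (the datum `(0, q)`), `covDeriv_chargeZero` (`D^η_{A} = ∂^η` at `e = 0`), `kinDiff`, `totalVertex`;
  **`action_eq_chargeZero_add_totalVertex`**: `S^ε_{C,(m²+δm²,λ,μ₀²,E)} = S^ε_{C₀,(m²,0,μ₀²,E)} + 𝒱(e)`; `totalVertex_of_e_zero`
  (`e = 0` ⇒ `𝒱 = V`); `abs_kinDiff_le` (the unitarity bound), **`totalVertex_bddBelow`**, **`abs_totalVertex_le`**,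
  `continuous_totalVertex`.
* §2 **`tiltData_free_totalVertex`** (BRICK 4's hypotheses for `ν⁰`, `𝒱(e)` and any continuous observable of polynomial
  growth), `…_one`, `…_twoPointObs`.
* §3 the family `totalFamily D P a b x x′`; **`totalFamily_one = twoPoint`** (unconditional); `totalFamily_of_e_zero =
  twoPointFamily`; for `m², μ₀², λ > 0` (any real `δm²`, ANY charge `e`): **`contDiffOn_totalFamily`**,
  **`iteratedDerivWithin_totalFamily_eq_ursellOf`** (coefficients = pinned truncated expectations w.r.t. the `e = 0`
  Gaussian of `φ_a(x)φ_b(x′)` and copies of `−𝒱(e)`), **`twoPoint_totalVertex_expansion`** (Taylor at `0⁺`, remainder).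
* §4 THE DICTIONARY WITH PRINT'S VERTICES: `vertices_eq` (`V = −[(1.6) + (1.7)]` with `λ(L^kε) = λ`, `δm_i² = δm²`,
  `(L^kε) = 1`), `vertex18_swap`/`vertex110_swap` (the `(0,j)`-vertex in the field `Ã := A` is the `(j,0)`-vertex in
  `g_kA′ := A`), **`neg_kinDiff_eq_vertices`** and **`neg_totalVertex_eq_vertices`**: for every `n̄`,
  `−𝒱(e) = (1.6) + (1.7) + Σ_{1≤j≤n̄}(1.8)_{j,0} + Σ_{j even, 2≤j≤n̄}(1.10)_{j,0} + (1.9)_{n̄} + (1.11)_{n̄}` over all bonds of the torus.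
HONEST SCOPE.  (i) The coefficients are identified as truncated expectations of the total vertex w.r.t. the `e = 0`
Gaussian; their evaluation as sums of graphs with BOTH propagators `C^ε_0` (scalar lines) and `C^ε` (vector lines) — Wick's
theorem for the polynomial vertices (1.6)–(1.8), (1.10) and a bound `O(e^{n̄+1})` for the R-vertex insertions — is NOT in
this file (BRICK 5's engine `B3GaussianPerturbationGraphs` is carrier-agnostic; the joint `(A, φ)` Gaussian instance is the
natural sequel); (ii) the expansion parameter `t` counts TOTAL vertices at fixed `(e, λ, δm²)`; print's double series in
`(e, λ)` is the regrouping of these coefficients by the charge orders `j` of the (1.8)/(1.10) factors (each `−𝒱(e)` is,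
modulo the R-vertices, a polynomial in `e` of degree `n̄`); (iii) `m² > 0`, `μ₀² > 0`, `λ > 0` (standing assumptions of
[I] p. 605; `λ > 0` is what makes `𝒱(e)` bounded below); (iv) derivatives one-sided at `t = 0`; nothing about `ε → 0`.
-/

open Finset MeasureTheory Filter Topology
open scoped ContDiff NNReal InnerProductSpace
open Literature.Probability.LatticeModels (ursellOf)
open Literature.MathematicalPhysics.QuantumFieldTheory.Balaban1983to89.B3TwoPointPerturbativeCoefficients
open Literature.MathematicalPhysics.QuantumFieldTheory.Balaban1983to89.B3Eq119VertexExpansion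

namespace Literature.MathematicalPhysics.QuantumFieldTheory.Balaban1983to89.B3Eq119TotalVertexFamily

/-! ## §1 The total vertex `𝒱(e) = V + ½(⟨φ,(−Δ^ε_A)φ⟩_e − ⟨φ,(−Δ^ε_0)φ⟩)` and its size -/

section TotalVertex

open Set
open HiggsLattice HiggsActionIntegrable B1Sect1Statements B3Sect1TwoPoint
open B1Eq113OneSidedDerivatives (quartic quartic_nonneg continuous_quartic covLaplaceForm_le)

variable {P : HiggsLattice.Params} {k N : ℕ}

/-- The charge datum `(e, q) ↦ (0, q)`: the same representation matrix `q`, charge switched off (the `e = 0` point of the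
expansion; [I] (1.12): «taking there e = λ = 0»). [cite: Balaban1982Higgs1, (1.12) p.606] -/
def chargeZero (C : HiggsLattice.ChargeData N) : HiggsLattice.ChargeData N := { C with e := 0 }

/-- The charge of `chargeZero C` is `0`. [cite: Balaban1982Higgs1, (1.12) p.606] -/
@[simp] theorem chargeZero_e (C : HiggsLattice.ChargeData N) : (chargeZero C).e = 0 := rfl

/-- The matrix of `chargeZero C` is `q`. [cite: Balaban1982Higgs1, (1.12) p.606] -/
@[simp] theorem chargeZero_q (C : HiggsLattice.ChargeData N) : (chargeZero C).q = C.q := rfl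

/-- A datum with `e = 0` is its own `chargeZero`. [cite: Balaban1982Higgs1, (1.12) p.606] -/
theorem chargeZero_eq_self_of_e_zero {C : HiggsLattice.ChargeData N} (h : C.e = 0) : chargeZero C = C := by
  cases C
  simp only [chargeZero]
  congr
  exact h.symm

/-- At charge `0`, `U(A) = exp(qε·0·A) = 1`. [cite: Balaban1982Higgs1, (1.7) p.605] -/
theorem U_chargeZero (C : HiggsLattice.ChargeData N) (η A : ℝ) : (chargeZero C).U η A = 1 := by
  unfold ChargeData.U
  have hz : (η * (chargeZero C).e * A) • (chargeZero C).q = 0 := by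
    rw [chargeZero_e, mul_zero, zero_mul]
    exact zero_smul ℝ (chargeZero C).q
  rw [hz, NormedSpace.exp_zero]

/-- **At charge `0` the covariant derivative (I.1.7) is the difference derivative (I.1.4)**: `D^η_A φ = ∂^η φ` for every `A`
(`−Δ^ε_0` of print's `C^ε_0 = (−Δ^ε_0 + m²)^{−1}`). [cite: Balaban1983Higgs3, (1.21) p.416] -/
theorem covDeriv_chargeZero (C : HiggsLattice.ChargeData N) (A : HiggsLattice.VecField P k)
    (φ : HiggsLattice.ScalarField P k N) (b : HiggsLattice.PBond P k) :
    covDeriv (chargeZero C) A φ b = sderiv φ b := by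
  unfold covDeriv sderiv
  rw [U_chargeZero]
  rfl

/-- At charge `0` the covariant kinetic form does not see the vector field: `⟨φ,(−Δ^η_A)φ⟩_{e=0} = ⟨φ,(−Δ^η_0)φ⟩`.
[cite: Balaban1983Higgs3, (1.21) p.416] -/
theorem covLaplaceForm_chargeZero (C : HiggsLattice.ChargeData N) (A : HiggsLattice.VecField P k)
    (φ : HiggsLattice.ScalarField P k N) :
    covLaplaceForm (chargeZero C) A φ = covLaplaceForm C 0 φ := by
  unfold covLaplaceForm
  refine Finset.sum_congr rfl fun b _ => ?_
  rw [covDeriv_chargeZero, covDeriv_zero]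

/-- **The kinetic difference** `½(⟨φ,(−Δ^ε_A)φ⟩_e − ⟨φ,(−Δ^ε_0)φ⟩)` — minus the sum of all the charged vertices
(1.8)/(1.10) [(1.9)/(1.11)] of the action at `B̃ = 0`, `g_k = 1` (§4). [cite: Balaban1983Higgs3, (1.8)–(1.11) p.413] -/
noncomputable def kinDiff (C : HiggsLattice.ChargeData N) (Φ : Cfg P k N) : ℝ :=
  (covLaplaceForm C Φ.1 Φ.2 - covLaplaceForm (chargeZero C) Φ.1 Φ.2) / 2

/-- **The total vertex** `𝒱(e)(A,φ) = V(φ) + ½(⟨φ,(−Δ^ε_A)φ⟩_e − ⟨φ,(−Δ^ε_0)φ⟩)`: minus the sum of ALL of print's vertices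
«(1.6), (1.7) [with δm²], (1.8), and (1.10) with n′ = 0, B̃ = 0, g_k = 1» of the action (1.20) relative to the `e = 0`,
`λ = 0` free action (§4 for the dictionary). [cite: Balaban1983Higgs3, (1.20)–(1.21) p.416] -/
noncomputable def totalVertex (C : HiggsLattice.ChargeData N) (lam dm2 : ℝ) (Φ : Cfg P k N) : ℝ :=
  vertices P k lam dm2 Φ.2 + kinDiff C Φ

/-- **`S^ε_{e,(m²+δm², λ, μ₀², E)} = S^ε_{0,(m², 0, μ₀², E)} + 𝒱(e)`**: the action (1.20) at charge `e` is the `e = 0`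
massive free action plus the total vertex. [cite: Balaban1983Higgs3, (1.20) p.416] -/
theorem action_eq_chargeZero_add_totalVertex (C : HiggsLattice.ChargeData N) (msq dm2 lam mu0sq E : ℝ)
    (Φ : Cfg P k N) :
    action C ⟨msq + dm2, lam, mu0sq, E⟩ Φ.1 Φ.2
      = action (chargeZero C) ⟨msq, 0, mu0sq, E⟩ Φ.1 Φ.2 + totalVertex C lam dm2 Φ := by
  rw [action_eq_free_add_vertices]
  unfold totalVertex kinDiff action
  ring

/-- At `e = 0` the kinetic difference vanishes. [cite: Balaban1983Higgs3, (1.21) p.416] -/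
theorem kinDiff_of_e_zero {C : HiggsLattice.ChargeData N} (h : C.e = 0) (Φ : Cfg P k N) : kinDiff C Φ = 0 := by
  unfold kinDiff
  rw [chargeZero_eq_self_of_e_zero h, sub_self, zero_div]

/-- At `e = 0` the total vertex is BRICK 4's `V` = −[(1.6) + (1.7)]. [cite: Balaban1983Higgs3, (1.20) p.416] -/
theorem totalVertex_of_e_zero {C : HiggsLattice.ChargeData N} (h : C.e = 0) (lam dm2 : ℝ) (Φ : Cfg P k N) :
    totalVertex C lam dm2 Φ = vertices P k lam dm2 Φ.2 := by
  unfold totalVertex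
  rw [kinDiff_of_e_zero h, add_zero]

/-- The quadratic functional `Q(φ) = Σ_x η^d|φ(x)|²` (the mass-term shape). [cite: Balaban1982Higgs1, (1.11) p.605] -/
noncomputable def sqMass (P : HiggsLattice.Params) (k : ℕ) (φ : HiggsLattice.ScalarField P k N) : ℝ :=
  ∑ x : HiggsLattice.Site P k, P.mesh k ^ P.d * ‖φ x‖ ^ 2

/-- `Q(φ) ≥ 0`. [cite: Balaban1982Higgs1, (1.11) p.605] -/
theorem sqMass_nonneg (φ : HiggsLattice.ScalarField P k N) : 0 ≤ sqMass P k φ :=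
  Finset.sum_nonneg fun _ _ => mul_nonneg (pow_nonneg (P.mesh_pos k).le _) (sq_nonneg _)

/-- `Q(φ) ≤ |T|(1 + η^d)(V₄(φ) + 1)` (sitewise `η^d|φ(x)|² ≤ V₄ + η^d`). [cite: Balaban1983Higgs3, (1.20) p.416] -/
theorem sqMass_le_quartic (φ : HiggsLattice.ScalarField P k N) :
    sqMass P k φ ≤ Fintype.card (HiggsLattice.Site P k) * (1 + P.mesh k ^ P.d) * (quartic P k φ + 1) := by
  have hη : 0 < P.mesh k ^ P.d := pow_pos (P.mesh_pos k) _
  have hq : 0 ≤ quartic P k φ := quartic_nonneg φ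
  have hsite : ∀ x : HiggsLattice.Site P k, P.mesh k ^ P.d * ‖φ x‖ ^ 2 ≤ (1 + P.mesh k ^ P.d) * (quartic P k φ + 1) := by
    intro x
    have h2 := norm_sq_le_quartic φ x
    have h2' : P.mesh k ^ P.d * ‖φ x‖ ^ 2 ≤ quartic P k φ + P.mesh k ^ P.d := by
      have := mul_le_mul_of_nonneg_left h2 hη.le
      rw [mul_add, ← mul_assoc, mul_inv_cancel₀ hη.ne', one_mul, mul_one] at this
      exact this
    nlinarith
  calc sqMass P k φ = ∑ x : HiggsLattice.Site P k, P.mesh k ^ P.d * ‖φ x‖ ^ 2 := rfl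
    _ ≤ ∑ _x : HiggsLattice.Site P k, (1 + P.mesh k ^ P.d) * (quartic P k φ + 1) := Finset.sum_le_sum fun x _ => hsite x
    _ = _ := by rw [Finset.sum_const, Finset.card_univ, nsmul_eq_mul]; ring

/-- The constant `κ = 2dη^{−2}` of the unitarity bound. [cite: Balaban1982Higgs1, (1.11) p.605] -/
noncomputable def kinConst (P : HiggsLattice.Params) (k : ℕ) : ℝ := 2 * P.d * (P.mesh k)⁻¹ ^ 2

/-- `κ ≥ 0`. [cite: Balaban1982Higgs1, (1.11) p.605] -/
theorem kinConst_nonneg (P : HiggsLattice.Params) (k : ℕ) : 0 ≤ kinConst P k := by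
  unfold kinConst; positivity

/-- The covariant kinetic form is non-negative. [cite: Balaban1982Higgs1, (1.11) p.605] -/
theorem covLaplaceForm_nonneg (C : HiggsLattice.ChargeData N) (A : HiggsLattice.VecField P k)
    (φ : HiggsLattice.ScalarField P k N) : 0 ≤ covLaplaceForm C A φ :=
  Finset.sum_nonneg fun _ _ => mul_nonneg (pow_nonneg (P.mesh_pos k).le _) (sq_nonneg _)

/-- Upper half of the unitarity bound: `½(⟨φ,(−Δ_A)φ⟩_e − ⟨φ,(−Δ_0)φ⟩) ≤ κ Q(φ)`. [cite: Balaban1982Higgs1, (1.11) p.605] -/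
theorem kinDiff_le (C : HiggsLattice.ChargeData N) (Φ : Cfg P k N) : kinDiff C Φ ≤ kinConst P k * sqMass P k Φ.2 := by
  unfold kinDiff kinConst sqMass
  have h1 := covLaplaceForm_le C Φ.1 Φ.2
  have h2 := covLaplaceForm_nonneg (chargeZero C) Φ.1 Φ.2
  nlinarith

/-- Lower half of the unitarity bound: `−κ Q(φ) ≤ ½(⟨φ,(−Δ_A)φ⟩_e − ⟨φ,(−Δ_0)φ⟩)`. [cite: Balaban1982Higgs1, (1.11) p.605] -/
theorem neg_kinDiff_le (C : HiggsLattice.ChargeData N) (Φ : Cfg P k N) : -(kinConst P k * sqMass P k Φ.2) ≤ kinDiff C Φ := by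
  unfold kinDiff kinConst sqMass
  have h1 := covLaplaceForm_le (chargeZero C) Φ.1 Φ.2
  have h2 := covLaplaceForm_nonneg C Φ.1 Φ.2
  nlinarith

/-- **The unitarity bound**: `|½(⟨φ,(−Δ^η_A)φ⟩_e − ⟨φ,(−Δ^η_0)φ⟩)| ≤ 2dη^{−2}Σ_x η^d|φ(x)|²`, UNIFORMLY in the vector field `A`
and the charge `e` (`U(A_b)` is an isometry of `ℝ^N`; `covLaplaceForm_le`). [cite: Balaban1982Higgs1, (1.7) p.605] -/
theorem abs_kinDiff_le (C : HiggsLattice.ChargeData N) (Φ : Cfg P k N) : |kinDiff C Φ| ≤ kinConst P k * sqMass P k Φ.2 :=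
  abs_le.2 ⟨neg_kinDiff_le C Φ, kinDiff_le C Φ⟩

/-- Shifting the mass counterterm absorbs a quadratic functional: `V_{λ,δm²}(φ) − κQ(φ) = V_{λ,δm²−2κ}(φ)`.
[cite: Balaban1983Higgs3, (1.20) p.416] -/
theorem vertices_sub_sqMass (lam dm2 κ : ℝ) (φ : HiggsLattice.ScalarField P k N) :
    vertices P k lam dm2 φ - κ * sqMass P k φ = vertices P k lam (dm2 - 2 * κ) φ := by
  unfold vertices sqMass
  rw [Finset.mul_sum, ← Finset.sum_sub_distrib]
  exact Finset.sum_congr rfl fun x _ => by ring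

/-- **The total vertex is bounded below** for `λ > 0`, uniformly in `A` and `e`:
`𝒱(e)(A,φ) ≥ −|T|η^d(δm² − 2κ)²/(16λ)` (the quartic vertex (1.6) beats the quadratic defect sitewise). [cite: Balaban1983Higgs3, (1.20) p.416] -/
theorem totalVertex_bddBelow (C : HiggsLattice.ChargeData N) {lam : ℝ} (hlam : 0 < lam) (dm2 : ℝ) (Φ : Cfg P k N) :
    -(Fintype.card (HiggsLattice.Site P k) * (P.mesh k ^ P.d * ((dm2 - 2 * kinConst P k) ^ 2 / (16 * lam))))
      ≤ totalVertex C lam dm2 Φ := by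
  have h1 := vertices_bddBelow (P := P) (k := k) hlam (dm2 - 2 * kinConst P k) Φ.2
  have h2 := neg_kinDiff_le C Φ
  have h3 := vertices_sub_sqMass lam dm2 (kinConst P k) Φ.2
  unfold totalVertex
  linarith

/-- The constant of `|𝒱(e)| ≤ K_𝒱 (V₄ + 1)`: `K_V + κ|T|(1 + η^d)`. [cite: Balaban1983Higgs3, (1.20) p.416] -/
noncomputable def totalVertexBoundConst (P : HiggsLattice.Params) (k : ℕ) (lam dm2 : ℝ) : ℝ :=
  vertexBoundConst P k lam dm2 + kinConst P k * (Fintype.card (HiggsLattice.Site P k) * (1 + P.mesh k ^ P.d))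

/-- `K_𝒱 ≥ 0`. [cite: Balaban1983Higgs3, (1.20) p.416] -/
theorem totalVertexBoundConst_nonneg (P : HiggsLattice.Params) (k : ℕ) (lam dm2 : ℝ) :
    0 ≤ totalVertexBoundConst P k lam dm2 := by
  unfold totalVertexBoundConst vertexBoundConst
  have := pow_nonneg (P.mesh_pos k).le P.d
  have := kinConst_nonneg P k
  positivity

/-- **`|𝒱(e)(A,φ)| ≤ K_𝒱 (V₄(φ) + 1)`** with `V₄ = Σ_x η^d|φ(x)|⁴` — polynomial growth in `φ`, NO growth in `A` (unitarity).
[cite: Balaban1983Higgs3, (1.20) p.416] -/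
theorem abs_totalVertex_le (C : HiggsLattice.ChargeData N) (lam dm2 : ℝ) (Φ : Cfg P k N) :
    |totalVertex C lam dm2 Φ| ≤ totalVertexBoundConst P k lam dm2 * (quartic P k Φ.2 + 1) := by
  unfold totalVertex totalVertexBoundConst
  have h1 := abs_vertices_le (P := P) (k := k) lam dm2 Φ.2
  have h2 := abs_kinDiff_le C Φ
  have h3 := sqMass_le_quartic (P := P) (k := k) Φ.2
  have hκ := kinConst_nonneg P k
  calc |vertices P k lam dm2 Φ.2 + kinDiff C Φ| ≤ |vertices P k lam dm2 Φ.2| + |kinDiff C Φ| := abs_add_le _ _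
    _ ≤ vertexBoundConst P k lam dm2 * (quartic P k Φ.2 + 1) + kinConst P k * sqMass P k Φ.2 := add_le_add h1 h2
    _ ≤ vertexBoundConst P k lam dm2 * (quartic P k Φ.2 + 1)
        + kinConst P k * (Fintype.card (HiggsLattice.Site P k) * (1 + P.mesh k ^ P.d) * (quartic P k Φ.2 + 1)) := by
        gcongr
    _ = _ := by ring

/-- The covariant kinetic form is jointly continuous in `(A, φ)`. [cite: Balaban1982Higgs1, (1.11) p.605] -/
theorem continuous_covLaplaceForm (C : HiggsLattice.ChargeData N) :
    Continuous fun Φ : Cfg P k N => covLaplaceForm C Φ.1 Φ.2 := by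
  unfold covLaplaceForm
  exact continuous_finsetSum _ fun b _ => (((continuous_covDeriv C b).norm).pow 2).const_mul _

/-- The kinetic difference is continuous. [cite: Balaban1983Higgs3, (1.20) p.416] -/
theorem continuous_kinDiff (C : HiggsLattice.ChargeData N) : Continuous fun Φ : Cfg P k N => kinDiff C Φ := by
  unfold kinDiff
  exact ((continuous_covLaplaceForm C).sub (continuous_covLaplaceForm (chargeZero C))).div_const _

/-- The total vertex is continuous. [cite: Balaban1983Higgs3, (1.20) p.416] -/
theorem continuous_totalVertex (C : HiggsLattice.ChargeData N) (lam dm2 : ℝ) :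
    Continuous fun Φ : Cfg P k N => totalVertex C lam dm2 Φ := by
  unfold totalVertex
  exact ((continuous_vertices lam dm2).comp continuous_snd).add (continuous_kinDiff C)

/-! ## §2 BRICK 4's hypotheses `TiltData` for the `e = 0` Gaussian, the total vertex, and polynomial observables -/

/-- **The hypotheses `TiltData` hold** for the `e = 0` free measure `ν⁰ = exp(−S^ε_{0,(m²,0,μ₀²,0)})dAdφ` (the free scalar
field with propagator `C^ε_0` and the free vector field with propagator `C^ε`, independent), the total vertex `𝒱(e)` at ANY
charge `e` (`λ > 0`, `m² > 0`, `μ₀² > 0`, any real `δm²`), and ANY continuous observable of polynomial growth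
`|F| ≤ K(V₄ + 1)ⁿ`. [cite: Balaban1983Higgs3, (1.19) p.416] -/
theorem tiltData_free_totalVertex {msq mu0sq lam : ℝ} (hm : 0 < msq) (hmu : 0 < mu0sq) (hlam : 0 < lam)
    (C : HiggsLattice.ChargeData N) (dm2 : ℝ) {F : Cfg P k N → ℝ} (hF : Continuous F) {K : ℝ} {n : ℕ}
    (hb : ∀ Φ, |F Φ| ≤ K * (quartic P k Φ.2 + 1) ^ n) :
    TiltData (freeMeasure P k N (chargeZero C) msq mu0sq) F (totalVertex C lam dm2) where
  aesm_F := hF.aestronglyMeasurable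
  aesm_V := (continuous_totalVertex C lam dm2).aestronglyMeasurable
  bddBelow := by
    refine ⟨Fintype.card (HiggsLattice.Site P k) * (P.mesh k ^ P.d * ((dm2 - 2 * kinConst P k) ^ 2 / (16 * lam))), ?_,
      fun Φ => totalVertex_bddBelow C hlam dm2 Φ⟩
    have := pow_nonneg (P.mesh_pos k).le P.d
    positivity
  integrable k' := by
    rw [integrable_freeMeasure_iff]
    have hK : 0 ≤ K := by
      have h0 := hb 0
      have hq0 : 0 ≤ quartic P k (0 : Cfg P k N).2 := quartic_nonneg _
      have hq : (0 : ℝ) < (quartic P k (0 : Cfg P k N).2 + 1) ^ n := pow_pos (by linarith) n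
      nlinarith [abs_nonneg (F 0)]
    have hKV : 0 ≤ totalVertexBoundConst P k lam dm2 := totalVertexBoundConst_nonneg P k lam dm2
    have h := integrable_mul_exp_of_le_pow_quartic hm hmu (chargeZero C) 0
      (h := fun Φ : Cfg P k N => F Φ * totalVertex C lam dm2 Φ ^ k')
      (hF.mul ((continuous_totalVertex C lam dm2).pow k'))
      (K := K * totalVertexBoundConst P k lam dm2 ^ k') (n := n + k') (fun Φ => by
        rw [abs_mul, abs_pow, pow_add, mul_mul_mul_comm, ← mul_pow]
        exact mul_le_mul (hb Φ) (pow_le_pow_left₀ (abs_nonneg _) (abs_totalVertex_le C lam dm2 Φ) k')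
          (pow_nonneg (abs_nonneg _) _) (mul_nonneg hK (pow_nonneg (by linarith [quartic_nonneg (P := P) (k := k) Φ.2]) _)))
    exact h.congr (Eventually.of_forall fun Φ => by simp only; ring)

/-- The constant observable `1` (the partition function of the family). [cite: Balaban1983Higgs3, (1.19) p.416] -/
theorem tiltData_free_totalVertex_one {msq mu0sq lam : ℝ} (hm : 0 < msq) (hmu : 0 < mu0sq) (hlam : 0 < lam)
    (C : HiggsLattice.ChargeData N) (dm2 : ℝ) :
    TiltData (freeMeasure P k N (chargeZero C) msq mu0sq) (fun _ => (1 : ℝ)) (totalVertex C lam dm2) :=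
  tiltData_free_totalVertex hm hmu hlam C dm2 continuous_const (K := 1) (n := 0) fun Φ => by simp

/-- The two-point observable `φ_a(x)φ_b(x′)` of (1.19). [cite: Balaban1983Higgs3, (1.19) p.416] -/
theorem tiltData_free_totalVertex_twoPointObs {msq mu0sq lam : ℝ} (hm : 0 < msq) (hmu : 0 < mu0sq) (hlam : 0 < lam)
    (C : HiggsLattice.ChargeData N) (dm2 : ℝ) (a b : Fin N) (x x' : HiggsLattice.Site P k) :
    TiltData (freeMeasure P k N (chargeZero C) msq mu0sq) (fun Φ => Φ.2 x a * Φ.2 x' b) (totalVertex C lam dm2) :=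
  tiltData_free_totalVertex hm hmu hlam C dm2 (continuous_twoPointObs a b x x') (abs_twoPointObs_le a b x x')

end TotalVertex

/-! ## §3 The total-vertex-weighted family of two-point functions at charge `e` and the headline theorems -/

section Model

open Set
open HiggsLattice HiggsActionIntegrable B1Sect1Statements B3Sect1TwoPoint

variable (D : ModelData) (P : HiggsLattice.Params)

/-- **The total-vertex-weighted two-point family at charge `e`**:
`t ↦ G^ε_{t,ab}(x,x′) := ⟨φ_a(x)φ_b(x′) e^{−t𝒱(e)}⟩_{ν⁰} / ⟨e^{−t𝒱(e)}⟩_{ν⁰}`, `ν⁰` the `e = 0` massive Gaussian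
`exp(−S^ε_{0,(m²,0,μ₀²,0)})dAdφ`, `𝒱(e)` the total vertex at the model's charge `e`, coupling `λ` and counterterm
`δm² = δm²(ε, e, λ)`; at `t = 1` it is (1.19). [cite: Balaban1983Higgs3, (1.19) p.416] -/
noncomputable def totalFamily (a b : Fin D.N) (x x' : HiggsLattice.Site P 0) : ℝ → ℝ :=
  tiltExpect (freeMeasure P 0 D.N (chargeZero D.C) D.msq D.mu0sq) (fun Φ => Φ.2 x a * Φ.2 x' b)
    (totalVertex D.C D.lam (D.δmsq P.ε D.C.e D.lam))

/-- **(1.19) is the `t = 1` value of the total-vertex family, at ANY charge `e`**: `G^ε_{ab}(x,x′) = totalFamily 1` (the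
typer's CONCRETE `B3Sect1TwoPoint.twoPoint`, by `S^ε_e + V = S^ε_{0,λ=0} + 𝒱(e)`). [cite: Balaban1983Higgs3, (1.19) p.416] -/
theorem totalFamily_one (a b : Fin D.N) (x x' : HiggsLattice.Site P 0) :
    totalFamily D P a b x x' 1 = twoPoint D P a b x x' := by
  unfold totalFamily tiltExpect tiltZ tiltMoment twoPoint z120 partitionFn
  rw [integral_freeMeasure, integral_freeMeasure, inv_mul_eq_div]
  have hact : ∀ Φ : Cfg P 0 D.N, action120 D P Φ.1 Φ.2
      = action (chargeZero D.C) ⟨D.msq, 0, D.mu0sq, 0⟩ Φ.1 Φ.2 + totalVertex D.C D.lam (D.δmsq P.ε D.C.e D.lam) Φ :=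
    fun Φ => action_eq_chargeZero_add_totalVertex D.C D.msq _ D.lam D.mu0sq 0 Φ
  congr 1
  · refine integral_congr_ae (Eventually.of_forall fun Φ => ?_)
    dsimp only
    rw [hact, neg_add, Real.exp_add]
    simp only [pow_zero, mul_one, one_mul]
    ring
  · refine integral_congr_ae (Eventually.of_forall fun Φ => ?_)
    dsimp only
    rw [show action D.C ⟨D.msq + D.δmsq P.ε D.C.e D.lam, D.lam, D.mu0sq, 0⟩ Φ.1 Φ.2
        = action (chargeZero D.C) ⟨D.msq, 0, D.mu0sq, 0⟩ Φ.1 Φ.2 + totalVertex D.C D.lam (D.δmsq P.ε D.C.e D.lam) Φ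
        from action_eq_chargeZero_add_totalVertex D.C D.msq _ D.lam D.mu0sq 0 Φ, neg_add, Real.exp_add]
    simp

/-- **At `e = 0` the total-vertex family IS BRICK 4's vertex-weighted family** `twoPointFamily` (the vector vertices are
absent). [cite: Balaban1983Higgs3, (1.21) p.416] -/
theorem totalFamily_of_e_zero (h : D.C.e = 0) (a b : Fin D.N) (x x' : HiggsLattice.Site P 0) :
    totalFamily D P a b x x' = twoPointFamily D P a b x x' := by
  unfold totalFamily twoPointFamily
  rw [chargeZero_eq_self_of_e_zero h]
  congr 1
  funext Φ
  exact totalVertex_of_e_zero h _ _ Φ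

variable {D P}

/-- **The total-vertex family is `C^∞` on `[0, ∞)`** (`m² > 0`, `μ₀² > 0`, `λ > 0`; ANY charge `e`, any real `δm²`).
[cite: Balaban1983Higgs3, (1.21) p.416] -/
theorem contDiffOn_totalFamily (hm : 0 < D.msq) (hmu : 0 < D.mu0sq) (hlam : 0 < D.lam) (a b : Fin D.N)
    (x x' : HiggsLattice.Site P 0) : ContDiffOn ℝ ∞ (totalFamily D P a b x x') (Ici 0) := by
  haveI := freeMeasure_neZero (P := P) (k := 0) (N := D.N) (chargeZero D.C) D.msq hmu
  exact (tiltData_free_totalVertex_twoPointObs hm hmu hlam D.C _ a b x x').contDiffOn_tiltExpect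
    (tiltData_free_totalVertex_one hm hmu hlam D.C _)

/-- **The `t`-derivatives of the total-vertex family, to every order, are the pinned truncated expectations**
`⟨φ_a(x)φ_b(x′); −𝒱(e); …; −𝒱(e)⟩ᵀ_t` — at `t = 0`: truncated expectations W.R.T. THE `e = 0` GAUSSIAN of the observable and
`|W|` copies of minus the total vertex, i.e. (§4) of the sum of print's vertices (1.6), (1.7), (1.8)_{j,0}, (1.10)_{j,0}
(`j ≤ n̄`) and the R-vertices of order `n̄ + 1` («the expansion of G^ε»: vertices contracted by the free propagators of BOTH
fields, only connected expressions surviving the division by `Z^ε`). [cite: Balaban1983Higgs3, (1.21) p.416]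
[cite: Mastropietro2008, §2.3 (2.32)-(2.38)] -/
theorem iteratedDerivWithin_totalFamily_eq_ursellOf (hm : 0 < D.msq) (hmu : 0 < D.mu0sq) (hlam : 0 < D.lam)
    (a b : Fin D.N) (x x' : HiggsLattice.Site P 0) {t : ℝ} (ht : 0 ≤ t) {β : Type*} [DecidableEq β] {j : β} {W : Finset β}
    (hjW : j ∉ W) :
    iteratedDerivWithin W.card (totalFamily D P a b x x') (Ici 0) t
      = ursellOf (pinnedMoments j
          (tiltMoment (freeMeasure P 0 D.N (chargeZero D.C) D.msq D.mu0sq) (fun Φ => Φ.2 x a * Φ.2 x' b)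
            (totalVertex D.C D.lam (D.δmsq P.ε D.C.e D.lam)) 0)
          (tiltZ (freeMeasure P 0 D.N (chargeZero D.C) D.msq D.mu0sq) (totalVertex D.C D.lam (D.δmsq P.ε D.C.e D.lam)))
          (Ici 0) t) (insert j W) := by
  haveI := freeMeasure_neZero (P := P) (k := 0) (N := D.N) (chargeZero D.C) D.msq hmu
  exact (tiltData_free_totalVertex_twoPointObs hm hmu hlam D.C _ a b x x').iteratedDerivWithin_tiltExpect_eq_ursellOf
    (tiltData_free_totalVertex_one hm hmu hlam D.C _) ht hjW

/-- **«The function `G^ε` has a perturbative expansion» (p. 416), CHARGED SECTOR INCLUDED** — in the number of total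
vertices, to every order, with Lagrange remainder: for every `n` there is `ξ ∈ (0, 1)` with
`G^ε_{ab}(x,x′) = Σ_{k ≤ n} (1/k!)(d/dt)^k G^ε_t|_{t=0⁺} + (1/(n+1)!)(d/dt)^{n+1}G^ε_t|_{t=ξ}`, the `k`-th coefficient being (by
`iteratedDerivWithin_totalFamily_eq_ursellOf`) the truncated expectation with `k` total vertices — each the sum of print's
(1.6), (1.7), (1.8), (1.10) [+ R-vertices] — of the `e = 0` Gaussian. [cite: Balaban1983Higgs3, (1.21) p.416] -/
theorem twoPoint_totalVertex_expansion (hm : 0 < D.msq) (hmu : 0 < D.mu0sq) (hlam : 0 < D.lam) (a b : Fin D.N)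
    (x x' : HiggsLattice.Site P 0) (n : ℕ) :
    ∃ ξ ∈ Ioo (0 : ℝ) 1, twoPoint D P a b x x'
      = ∑ k ∈ Finset.range (n + 1),
          iteratedDerivWithin k (totalFamily D P a b x x') (Ici 0) 0 / (k.factorial : ℝ)
        + iteratedDerivWithin (n + 1) (totalFamily D P a b x x') (Ici 0) ξ / ((n + 1).factorial : ℝ) := by
  haveI := freeMeasure_neZero (P := P) (k := 0) (N := D.N) (chargeZero D.C) D.msq hmu
  obtain ⟨ξ, hξ, h⟩ :=
    (tiltData_free_totalVertex_twoPointObs hm hmu hlam D.C (D.δmsq P.ε D.C.e D.lam) a b x x').taylor_tiltExpect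
      (tiltData_free_totalVertex_one hm hmu hlam D.C _) n one_pos
  refine ⟨ξ, hξ, ?_⟩
  rw [← totalFamily_one, totalFamily, h]
  simp

end Model

/-! ## §4 The dictionary: `−𝒱(e)` is the sum of print's vertices (1.6), (1.7), (1.8)_{j,0}, (1.10)_{j,0}, (1.9), (1.11) -/

section Dictionary

open HiggsLattice
open B3Eq18VertexExpansion (vertex16 vertex17 vertex18 vertex19 vertex110 vertex111 gmul kinBond taylorCoeff_kinBond
  vertex18_eq_sum vertex19_eq_sum vertex110_eq_sum vertex111_eq_sum)

variable {P : HiggsLattice.Params} {k N : ℕ}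

/-- **`V = −[(1.6) + (1.7)]`**: BRICK 4's scalar vertices are minus the typer's (1.6) (running coupling `λ(L^kε) := λ`) and
(1.7) (`δm_i²(x) := δm²`, `(L^kε)² := 1` — p. 416: «η = ε (hence L^kε = 1)», «with δm² instead of δm_i²(x)») over the whole
torus `Ω₁ = T`. [cite: Balaban1983Higgs3, (1.6)–(1.7) p.413] -/
theorem vertices_eq (lam dm2 : ℝ) (φ : HiggsLattice.ScalarField P k N) :
    vertices P k lam dm2 φ = -(vertex16 lam Finset.univ φ + vertex17 (fun _ => dm2) 1 Finset.univ φ) := by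
  have h1 : vertex16 lam Finset.univ φ = -∑ x : HiggsLattice.Site P k, P.mesh k ^ P.d * (lam * ‖φ x‖ ^ 4) := by
    unfold vertex16
    rw [Finset.mul_sum]
    congr 1
    exact Finset.sum_congr rfl fun x _ => by ring
  have h2 : vertex17 (fun _ => dm2) 1 Finset.univ φ
      = -∑ x : HiggsLattice.Site P k, P.mesh k ^ P.d * (dm2 / 2 * ‖φ x‖ ^ 2) := by
    unfold vertex17
    rw [Finset.mul_sum, ← Finset.sum_neg_distrib]
    exact Finset.sum_congr rfl fun x _ => by dsimp only; ring
  rw [h1, h2, neg_add, neg_neg, neg_neg, ← Finset.sum_add_distrib]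
  unfold vertices
  exact Finset.sum_congr rfl fun x _ => by ring

/-- The `(0, j)`-vertex (1.8) in the field `Ã := A` (no `g_kA′` legs) is the `(j, 0)`-vertex (1.8) in the field `g_kA′ := A`,
`g_k = 1`, no `Ã` legs — print's «(1.8) with n′ = 0, g_k = 1». [cite: Balaban1983Higgs3, (1.8) p.413] -/
theorem vertex18_swap (C : HiggsLattice.ChargeData N) (g : HiggsLattice.Site P k → ℝ) (B A1 A : HiggsLattice.VecField P k)
    (φ : HiggsLattice.ScalarField P k N) (j : ℕ) (S : Finset (HiggsLattice.PBond P k)) :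
    vertex18 C g B A1 A φ 0 j S = vertex18 C (fun _ => (1 : ℝ)) B A 0 φ j 0 S := by
  unfold vertex18
  simp only [zero_add, add_zero, pow_zero, mul_one, one_mul, Nat.factorial_zero, Nat.cast_one, Nat.cast_zero]

/-- The same for (1.10): the `(0, j)`-vertex in `Ã := A` is the `(j, 0)`-vertex in `g_kA′ := A`, `g_k = 1`.
[cite: Balaban1983Higgs3, (1.10) p.413] -/
theorem vertex110_swap (C : HiggsLattice.ChargeData N) (g : HiggsLattice.Site P k → ℝ) (A1 A : HiggsLattice.VecField P k)
    (φ : HiggsLattice.ScalarField P k N) (j : ℕ) (S : Finset (HiggsLattice.PBond P k)) :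
    vertex110 C g A1 A φ 0 j S = vertex110 C (fun _ => (1 : ℝ)) A 0 φ j 0 S := by
  unfold vertex110
  simp only [zero_add, add_zero, pow_zero, mul_one, one_mul, Nat.factorial_zero, Nat.cast_one, Nat.cast_zero]

/-- One bond, value form of the typer's `taylorCoeff_kinBond` at `n = 0` (no `e′`-derivative), `B̃ = 0`, `g_kA′`-slot empty,
the field `A` in the `Ã`-slot expanded by (I.3.14) to the order `n̄`:
`−½η^d|(D^η_Aφ)(b)|² = −½η^d|(∂^ηφ)(b)|² + Σ_{1≤j≤n̄}(1.8)_{0,j} + (1.9) + Σ_{j even, 2≤j≤n̄}(1.10)_{0,j} + (1.11)` at the bond `b`.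
[cite: Balaban1983Higgs3, (1.8)–(1.11) p.413] -/
theorem kinetic_bond_eq_vertices (C : HiggsLattice.ChargeData N) (A : HiggsLattice.VecField P k)
    (φ : HiggsLattice.ScalarField P k N) (nbar : ℕ) (b : HiggsLattice.PBond P k) :
    -(1 / 2 : ℝ) * P.mesh k ^ P.d * ‖covDeriv C A φ b‖ ^ 2
      = -(1 / 2 : ℝ) * P.mesh k ^ P.d * ‖sderiv φ b‖ ^ 2
        + (∑ j ∈ (Finset.range (nbar + 1)).filter (fun j => 1 ≤ j),
            vertex18 C (fun _ => (1 : ℝ)) 0 0 A φ 0 j {b})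
        + vertex19 C (fun _ => (1 : ℝ)) 0 0 A φ nbar 0 {b}
        + (∑ j ∈ (Finset.range (nbar + 1)).filter (fun j => Even j ∧ 2 ≤ j),
            vertex110 C (fun _ => (1 : ℝ)) 0 A φ 0 j {b})
        + vertex111 C (fun _ => (1 : ℝ)) 0 A φ nbar 0 {b} := by
  have h := taylorCoeff_kinBond C (fun _ => (1 : ℝ)) 0 0 A φ nbar 0 b
  simp only [Nat.factorial_zero, Nat.cast_one, inv_one, one_mul, iteratedDeriv_zero, if_true, zero_add] at h
  have hkin : kinBond C (fun _ => (1 : ℝ)) 0 0 A φ b 0 = -(1 / 2 : ℝ) * P.mesh k ^ P.d * ‖covDeriv C A φ b‖ ^ 2 := by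
    unfold kinBond
    rw [zero_smul, zero_add, zero_add]
  rw [← hkin, h, covDeriv_zero]

/-- **The kinetic difference is minus the sum of the charged vertices** — for EVERY truncation order `n̄`:
`−½(⟨φ,(−Δ^η_A)φ⟩_e − ⟨φ,(−Δ^η_0)φ⟩) = Σ_{1≤j≤n̄}(1.8)_{j,0} + Σ_{j even, 2≤j≤n̄}(1.10)_{j,0} + (1.9)_{n̄} + (1.11)_{n̄}`, the
vertices summed over all bonds of the torus, at `B̃ = 0`, `g_k = 1`, the field `A` in the `g_kA′`-legs of (1.8)/(1.10) (print's
«with n′ = 0») and in the `Ã`-legs of the R-vertices (1.9)/(1.11), which carry the charge orders `> n̄`.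
[cite: Balaban1983Higgs3, (1.8)–(1.11) p.413] -/
theorem neg_kinDiff_eq_vertices (C : HiggsLattice.ChargeData N) (A : HiggsLattice.VecField P k)
    (φ : HiggsLattice.ScalarField P k N) (nbar : ℕ) :
    -kinDiff C (A, φ)
      = (∑ j ∈ (Finset.range (nbar + 1)).filter (fun j => 1 ≤ j),
            vertex18 C (fun _ => (1 : ℝ)) 0 A 0 φ j 0 Finset.univ)
        + (∑ j ∈ (Finset.range (nbar + 1)).filter (fun j => Even j ∧ 2 ≤ j),
            vertex110 C (fun _ => (1 : ℝ)) A 0 φ j 0 Finset.univ)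
        + vertex19 C (fun _ => (1 : ℝ)) 0 0 A φ nbar 0 Finset.univ
        + vertex111 C (fun _ => (1 : ℝ)) 0 A φ nbar 0 Finset.univ := by
  -- the kinetic difference, bond by bond
  have hsum : -kinDiff C (A, φ)
      = ∑ b : HiggsLattice.PBond P k, (-(1 / 2 : ℝ) * P.mesh k ^ P.d * ‖covDeriv C A φ b‖ ^ 2
          - (-(1 / 2 : ℝ) * P.mesh k ^ P.d * ‖sderiv φ b‖ ^ 2)) := by
    unfold kinDiff covLaplaceForm
    simp only [covDeriv_chargeZero]
    rw [← Finset.sum_sub_distrib, Finset.sum_div, ← Finset.sum_neg_distrib]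
    exact Finset.sum_congr rfl fun b _ => by ring
  rw [hsum]
  have hb : ∀ b : HiggsLattice.PBond P k,
      -(1 / 2 : ℝ) * P.mesh k ^ P.d * ‖covDeriv C A φ b‖ ^ 2 - -(1 / 2 : ℝ) * P.mesh k ^ P.d * ‖sderiv φ b‖ ^ 2
        = (∑ j ∈ (Finset.range (nbar + 1)).filter (fun j => 1 ≤ j), vertex18 C (fun _ => (1 : ℝ)) 0 A 0 φ j 0 {b})
          + (∑ j ∈ (Finset.range (nbar + 1)).filter (fun j => Even j ∧ 2 ≤ j), vertex110 C (fun _ => (1 : ℝ)) A 0 φ j 0 {b})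
          + vertex19 C (fun _ => (1 : ℝ)) 0 0 A φ nbar 0 {b}
          + vertex111 C (fun _ => (1 : ℝ)) 0 A φ nbar 0 {b} := by
    intro b
    rw [kinetic_bond_eq_vertices C A φ nbar b]
    simp only [vertex18_swap, vertex110_swap]
    ring
  rw [Finset.sum_congr rfl fun b _ => hb b]
  simp only [Finset.sum_add_distrib]
  rw [Finset.sum_comm, ← vertex19_eq_sum, ← vertex111_eq_sum]
  congr 1
  congr 1
  congr 1
  · exact Finset.sum_congr rfl fun j _ => (vertex18_eq_sum C _ 0 A 0 φ j 0 _).symm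
  · rw [Finset.sum_comm]
    exact Finset.sum_congr rfl fun j _ => (vertex110_eq_sum C _ A 0 φ j 0 _).symm

/-- **THE DICTIONARY — minus the total vertex is the sum of ALL of print's vertices**: for every charge datum `(e, q)`,
every `λ, δm²`, every configuration `(A, φ)` of the torus and EVERY truncation order `n̄`,
`−𝒱(e)(A,φ) = (1.6) + (1.7) + Σ_{1≤j≤n̄}(1.8)_{j,0} + Σ_{j even, 2≤j≤n̄}(1.10)_{j,0} + (1.9)_{n̄} + (1.11)_{n̄}`
(p. 416: «the only vertices are (1.6), (1.7) [with δm² instead of δm_i²(x)], (1.8), and (1.10) with n′ = 0, B̃ = 0, g_k = 1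
(but without any restrictions on n)» — print's formal series in the charge; here every finite `n̄` with the orders `> n̄`
resummed into the R-vertices (1.9)/(1.11) of p. 413). [cite: Balaban1983Higgs3, (1.21) p.416] -/
theorem neg_totalVertex_eq_vertices (C : HiggsLattice.ChargeData N) (lam dm2 : ℝ) (A : HiggsLattice.VecField P k)
    (φ : HiggsLattice.ScalarField P k N) (nbar : ℕ) :
    -totalVertex C lam dm2 (A, φ)
      = vertex16 lam Finset.univ φ + vertex17 (fun _ => dm2) 1 Finset.univ φ
        + (∑ j ∈ (Finset.range (nbar + 1)).filter (fun j => 1 ≤ j),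
            vertex18 C (fun _ => (1 : ℝ)) 0 A 0 φ j 0 Finset.univ)
        + (∑ j ∈ (Finset.range (nbar + 1)).filter (fun j => Even j ∧ 2 ≤ j),
            vertex110 C (fun _ => (1 : ℝ)) A 0 φ j 0 Finset.univ)
        + vertex19 C (fun _ => (1 : ℝ)) 0 0 A φ nbar 0 Finset.univ
        + vertex111 C (fun _ => (1 : ℝ)) 0 A φ nbar 0 Finset.univ := by
  unfold totalVertex
  rw [neg_add, vertices_eq, neg_neg, neg_kinDiff_eq_vertices C A φ nbar]
  ring

end Dictionary

end Literature.MathematicalPhysics.QuantumFieldTheory.Balaban1983to89.B3Eq119TotalVertexFamily
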